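import Summits.ResolutionOfSingularities.ResolutionOfSingularities.Theorems.PlanarSectionLiftClasses
import Summits.ResolutionOfSingularities.ResolutionOfSingularities.Theorems.ProximityCutArcLaw
import Summits.ResolutionOfSingularities.ResolutionOfSingularities.Theorems.MaxContactCutFreezeCut
import HarnessLib

/-!
# PlanarGhostDescentStates — decomp-res node «GhostDescent» (lens-5 g27, critic row 183 CLEARED DECIDED +1 · MAP 0),
tree file 1/3 of the node

Content VERBATIM from the decomp-res lens-5 g27 node `HOME/decomp-res-lens-5/g27/PlanarGhostDescent.lean` (pin
53b88513, 809 l, 34 decls; farm rc 0 · 0 sorry · std axioms;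
HOME = run/shared/lean/pub/decomp-res).  The node imports the LANDED tree only (`Theorems/PlanarSectionLiftClasses`,
`ProximityCutArcLaw`, `MaxContactCutFreezeCut`) and carries
nothing.  Critic: CRITIC-LEDGER row 183 CLEARED DECIDED +1 · MAP 0 («(T-2′) met and exceeded: a genuine tail law
consuming unboundedly many moves; one kernel law eliminates the WHOLE planar
kind, port-free ⇒ plain DECIDED +1»).  Landing orders lens-5 INBOX :923 + critic rider INBOX :931:
`Theorems/PlanarGhostDescentStates` (§1, l. 137–502) → `PlanarGhostDescent`
(§2–§3, l. 504–809), each continued `…B` where the tree's 400-line cap cuts, ONE namespace `…Theorems.GhostDescent`,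
`--kind proof --supports
stmt-ResolutionOfSingularities-31770`; then ITEM CLOSURE of the Theses aside 28121
`MaxContactCut.CFNoMonomialLedPlanarJointTailsDeep` (= `CoefficientCut.NoMonomialLedPlanarJointTailsDeep`
by definition) by `Theorems/MaxContactCutPlanarClosed.lean`.  These files import `MaxContactCutFreezeCut` and
therefore sit in the Theses cone (no aside is homed here; none is needed:
the planar column CLOSES).  Column bookkeeping (row 183): MaxContactCut PLANAR COLUMN CLOSED, node equation
`DefectWalksDeep ↔ NoSkewJointTailsDeep`; lens-5 keeps exactly its filed
skew aside(s) — no new aside, no switch.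

The lens header, verbatim:

> GhostDescent
> # PlanarGhostDescent — decomp-res node «GhostDescent» (lens-5 g27): THE PLANAR SIDE OF 31770 IS EMPTY (PROVED)
>
> decomp-res ROOT DECOMPOSITION CELL, lens «finite/base range + asymptotic regime + bridge», generation 27.
> HOME = run/shared/lean/pub/decomp-res; this file = `HOME/decomp-res-lens-5/g27/PlanarGhostDescent.lean` (the pinned
> node).  Namespace `…Theorems.GhostDescent`; imports TREE ONLY (the landed g25 node `Theorems.PlanarSectionLiftClasses`,
> lens-3's landed arc law `Theorems.ProximityCutArcLaw`, the landed `Theorems.MaxContactCutFreezeCut`) and reaches the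
> host target `MaxContactCut.DefectWalksDeep` (stmt-ResolutionOfSingularities-31770) BY NAME through the tree's exact cut
> `CoefficientCut.defectWalksDeep_iff_led_skew`.  `--supports stmt-ResolutionOfSingularities-31770`; in the Theses cone.
>
> ## Result (binding window g27 = CRITIC-LEDGER row 177 (T-2′): «+1 ONCE when the LOW-LIVE class
> `SectionLift.NoLowLiveTerminalSectionPlanarTailsDeep` is DECIDED by a hypothesis-free kernel TAIL LAW, then dropped from
> the node equation exactly»)
>
> * **`noMonomialLedPlanarJointTailsDeep_holds : CoefficientCut.NoMonomialLedPlanarJointTailsDeep`** — the PORT CLASS of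
>   g19–g26 (PIECE 1 of the joint residual: ALL planar tails in the monomial regime, ghost walls included) is EMPTY.
>   PROVED, 0 sorry, hypothesis-free, every `q = p^e`, every perfect field; no port, no [HP24] proposition.
> * hence BY NAME (tree implications only): `noMonomialPlanarJointTailsDeep_holds`, **`noPlanarJointTailsDeep_holds :
>   CoefficientCut.NoPlanarJointTailsDeep`** (the whole PLANAR WINDOW), `noHighPlanarJointTailsDeep_holds :
>   FreezeCut.NoHighPlanarJointTailsDeep` (the letter the other lenses' node equations carry),
>   `noNonTerminalSectionPlanarJointTailsDeep_holds` (g24's H-P half — WITHOUT `HP24Prop3`/`HP24Prop4`),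
>   `noTerminalSectionPlanarJointTailsDeep_holds`, **`noLowLiveTerminalSectionPlanarTailsDeep_holds :
>   SectionLift.NoLowLiveTerminalSectionPlanarTailsDeep`** ((T-2′), the window's target, BY NAME),
>   `noLowEmptyTerminalSectionPlanarTailsDeep_holds`, `noLowEmptyIsolatedSectionTailsDeep_holds` ((T-1′) again, now a
>   one-liner).
> * **THE NODE EQUATION, EXACT, hypothesis-free:** `defectWalksDeep_iff_skew : MaxContactCut.DefectWalksDeep ↔
>   CoefficientCut.NoSkewJointTailsDeep` and, on the current skew leaves (tree `StallVertex` rev 8),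
>   `defectWalksDeep_iff_skewLeaves : MaxContactCut.DefectWalksDeep ↔ StallVertex.NoPositiveSkewStalledTailsDeep ∧
>   StallVertex.NoNullFlatSkewStalledTailsDeep` — the arc law (`hA`), [HP24] Prop. 3/4 (`hP3`, `hP4`), the low-empty and
>   low-live section classes (`hE`, `hL`) of g24–g26's `closes` are ALL DISCHARGED by tree theorems and DROPPED.
> * **`closes (hR : NoSkewJointTailsDeep) : MaxContactCut.DefectWalksDeep`**, `closes_leaves (hI) (hZ)` — 31770 BY NAME
>   from the skew residual alone; `skew_of_defectWalksDeep` (necessity: the cut is exact).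
>
> ## The proof: GHOST DESCENT = g18's strict-multiplicity descent run on the WALL LAYER `0`, guarded by the ORDER WINDOW
>
> Setting (the class, tree binders verbatim): a planar tail along the wall `u_k` (never the chart, never translated in
> `u_k`) on an excess plateau (`ord F_t ≥ q + 1`), live wall layers `1 … q−1` MONOMIAL-LED (`hled`; by g18's potential
> this is the late regime of every planar tail), wall layer `0` NON-EMPTY (`h0`: a GHOST wall, `r_k = 0` — the massive
> case `u_k ∣ F` is g18's `noPlanarTails_of_layer_zero`), proximity repeats i.o. (`hS`), translated moves i.o. (`hb`).
> Write `S_t := layer k 0 F_t` (exponents with `d_k = 0`), `n₀(t) := loSum S_t` (its least degree), `e_t := sm S_t i j`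
> (its STRICT MULTIPLICITY `min(d_i+d_j) − min d_i − min d_j`, tree `PlanarCut.sm`: the multiplicity at the current point
> of the strict transform of the plane curve cut out by the layer).  g18 proved, for the layers `a = 1 … q−1` which the
> cleaning never touches: (M) `e` is non-increasing under a planar move, (P) `e'' + e' ≤ e` across a planar proximity
> repeat — and stopped at the wall layer `0` because a TRANSLATED move can create `q`-th powers there, which the cleaning
> deletes.  The node's one new observation is that ISOLATION FORBIDS THIS WHERE IT MATTERS:
>
> * **ORDER WINDOW (`loSum_zero_lt_two_mul`, PROVED):** at a translated move `t ≥ N` of the tail, `q < n₀(t) < 2q`.  The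
>   lower bound is the excess plateau.  For the upper bound suppose `n₀(t) ≥ 2q` and the move translates `u_i` (chart
>   `u_j`).  Every new exponent `d'` has an origin `d` in the same layer on the line `d_i + d_j + d_k = d'_j + q`
>   (`PlanarCut.origin_of_mem_layer_step`), so the new wall layer `0` has `d'_j ≥ q`; every live layer `a` is
>   monomial-led, so its lowest new row is the pure power `c·(u_i+b_i)^{x₀} u_j^{Y} u_k^{a}` with `u_j^Y u_k^a` PRESENT,
>   whence `Y + a ≥ q` by the order bound and the whole new layer has `d'_j + d'_k ≥ q` (g18's `fat_of_dead_layers`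
>   argument, here `fat_of_heavy_layer_zero`); layers `≥ q` trivially.  So `F_{t+1}` is FAT off `u_i` and its top locus
>   contains the `u_i`-axis (`PlanarCut.not_isolatedTop_of_fat`) — against `W.isolated (t+1)`.
> * **NO CLEANING ON THE LOWEST ROW:** hence at a translated move the lowest new row of the wall layer `0` sits at
>   `u_j`-exponent `Y = n₀ − q` with `0 < Y < q`: none of its exponents `(l, Y, 0)` is a `q`-th power, the cleaning does
>   not touch it, and its coefficients ARE those of g18's row polynomial `(X + b_i)^{x₀} · Q̃`, `deg Q̃ ≤ e_t`
>   (`coeff_step_row_zero`, `exists_low_exponent_zero`).  At an UNTRANSLATED move nothing is cleaned at all: the states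
>   are cleaned (`walk_clean`) and the chart exponent of a non-`q`-th power is a non-`q`-th power
>   (`isPthPowerExponent_of_chartExponent`, `chartExponent_mem_layer_step_of_clean`).
> * **(M) and (P) for the wall layer `0` (`sm_zero_step_le`, `sm_zero_step_step_le`, PROVED)** — g18's proofs verbatim
>   with `a = 0`, fed by the two facts above; walk forms `smz_succ_le`, `smz_succ_succ_le`, halving `two_mul_smz_le`.
> * **KILL:** the repeats drive `e` to `0` (`exists_smz_eq_zero`, strong induction as g18's `exists_pot_eq_zero`), i.e.
>   the wall layer `0` becomes MONOMIAL-LED at some `T ≥ N` — which the tree's g24 law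
>   `PlanarPort.layer_zero_not_monomialLed` (LAW A: a monomial-led layer `0` forbids every translated move; LAW B: it is
>   kept by untranslated ones; `hb` wants translated moves i.o.) FORBIDS.  `no_ghost_tail`; the class follows by
>   `CoefficientCut.sm_eq_zero_iff_isMonomialLed`.
>
> So the g18 lens statement now holds for EVERY wall: «finite range» = the wall-layer-`0` strict multiplicity `e_N`
> (at most `⌊log₂ e_N⌋` spaced proximity repeats are followed by a translated move), «asymptotic regime» = `e = 0`
> (monomial-led ghost wall: no translated move ever again), «bridge» = the order window.
>
> ## Pieces · tags (D-0171) · leaves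
>
> * WINDOW · `CoefficientCut.NoMonomialLedPlanarJointTailsDeep` (and BY LETTER every planar class above) · **DECIDED
>   (PROVED here, hypothesis-free)** · dropped from the node equation EXACTLY (`defectWalksDeep_iff_skew`).  Formerly
>   tagged COSTUME(BenitoVillamayor2012 Thm 2.11 + §4; KawanoueMatsuki2016 §4–§5)/PORT — no port is used: the proof is
>   the tree's own two-letter exponent calculus.
> * RESIDUAL · `CoefficientCut.NoSkewJointTailsDeep` (tree `CoefficientCutClasses` :173; every coordinate plane is
>   charted-or-translated i.o.) · UNDECIDED · **`≡` 31770 EXACTLY** (`defectWalksDeep_iff_skew`) — so it is NOT WEAKER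
>   than the target any more: it IS the target's located form · current split beneath it (tree, not restated):
>   `StallVertex.NoPositiveSkewStalledTailsDeep` (leaf IDEA-NEEDED ∧ INSTRUMENTABLE, tree tags) `∧`
>   `StallVertex.NoNullFlatSkewStalledTailsDeep` (leaf IDEA-NEEDED ∧ INSTRUMENTABLE), `defectWalksDeep_iff_skewLeaves`;
>   equivalently lens-3's `NoLossyStrictTailsDeep ∧ …` modulo its ports (`WallCut`, `NearCut`: their
>   `NoHighPlanarJointTailsDeep` conjunct is now `noHighPlanarJointTailsDeep_holds`).
> * Probes (`bc/Probe.lean`, MUST FAIL): the residual and each skew leaf are not closed by `assumption | exact? | aesop`,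
>   and neither skew leaf alone gives 31770 cheaply; controls: the proved classes and `closes` elaborate by name.
>
> WHY THIS IS NOVEL (one sentence): every generation since g18 treated the wall layer `0` as lost to the cleaning and
> went to PORTS (the H-P invariant, Benito–Villamayor, Kawanoue–Matsuki, the section functor, curve traps); the node
> shows instead that the walk's OWN isolation condition pins every translated move into the order window `q < n₀ < 2q`,
> where the lowest row of the wall layer `0` is `u_j^{n₀−q}` with `0 < n₀−q < q` and CANNOT be cleaned — so g18's
> two inequalities run on the ghost wall unchanged and the planar side of 31770 closes with no port at all.
>
> DECIDED-IN-TREE (used BY NAME, never restated): `PlanarCut.{lo, loSum, sm, layer, exp3, rowPoly, mem_layer, lo_le,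
> le_lo, loSum_le, le_loSum, exists_loSum_eq, lo_add_lo_le_loSum, loSum_comm, sm_comm, sm_empty, fin3_cases,
> degree_three, exp3_i, exp3_j, exp3_k, chartExponent_i, chartExponent_k, coeff_pointTransform_planar,
> origin_of_mem_layer_step, layer_step_eq_empty, eq_of_row, rowPoly_ne_zero, coeff_rowPoly, coeff_step_lowest_row,
> not_isolatedTop_of_fat, st_succ_F}` (g18), `PlanarPort.{translated_letter, layer_zero_not_monomialLed}` (g24),
> `CoefficientCut.{NoMonomialLedPlanarJointTailsDeep, NoPlanarJointTailsDeep, NoSkewJointTailsDeep,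
> sm_eq_zero_iff_isMonomialLed, monomialPlanar_iff_monomialLed, planar_iff_monomial, defectWalksDeep_iff_led_skew}`,
> `PlanarPort.{nonTerminalSection_of_monomialLed, terminalSection_of_monomialLed}`, `SectionLift.{lowLiveTerminal_of_terminal,
> lowEmptyTerminal_of_terminal, lowEmptyTerminal_iff_isolatedSection}`, `FreezeCut.planar_iff_highPlanar`,
> `StallVertex.defectWalksDeep_iff_positive_nullFlat`, `ProximityCut.{noFreePointTailsDeep_holds, chartExponent_self,
> chartExponent_erase, degree_erase_add, coeff_chartTransform_chartExponent, translate_zero_eq, le_degree_of_mem_support}`,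
> `ItineraryCutClasses.{walk_nat, walk_clean}`, `Hauser2010.{IsPthPowerExponent, isPthPowerExponent_iff, deletePthPowers,
> coeff_deletePthPowers, ordZero}`, `OrdZeroBasics.coeff_eq_zero_of_degree_lt_ordZero`, `PointBlowup.{step, pointTransform,
> translate, chartTransform, chartExponent}`, `TightDefectClasses.{ForcedWalk, IsRoot, IsolatedTop, StaysOnNewest}`.
> (Sources: Hauser2010 §§D–G (kangaroo points, cleaning); HauserPerlega2019/2024 (the defect walk); Moh1987;
> CossartJannsenSaito2020 Thm. 2.14 (the two-letter model); BenitoVillamayor2012 Thm. 2.11, §4 and KawanoueMatsuki2016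
> §4–§5 only as the now-unused ports of record.)

## This file

§1 STATE LEVEL — cleaning never touches what the descent uses (kernel): the state lemmas of the ghost descent on
Hauser's point-blow-up model `PointBlowup.State (Fin 3) K` (planar moves, the live / dead layers, the WALL LAYER
`0`): the two inequalities of the strict multiplicity of the wall layer `0` under planar moves (state level) and THE
ORDER WINDOW — a heavy wall layer `0` over dead live layers makes a translated move FAT (`fat_of_heavy_layer_zero`,
`not_isolatedTop_of_fat`) (continued `…B` where the 400-line cap cuts).  (This first part carries:
`not_isPthPowerExponent_of_clean`, `coeff_step_of_not_isPthPowerExponent`, `isPthPowerExponent_of_chartExponent`,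
`not_isPthPowerExponent_exp3`, `chartExponent_mem_layer_step_of_clean`, `coeff_step_row_zero`.)

[WRITER NOTE (decomp-res writer g11): file split only (tree files ≤ 400 lines); `noncomputable section`, namespace,
sections, section variables, the `open` lines and every
declaration exactly as in the lens; no instance, no notation, no include/omit added.]

(Sources: Hauser2010Kangaroo §F; HauserPerlega2019; HauserPerlega2024; Moh1987; CossartPiltant2008;
CossartJannsenSaito2020 Ch. 6.)
-/

noncomputable section

open MvPolynomial Finset
open Literature.AlgebraicGeometry.Resolution
open Literature.AlgebraicGeometry.Resolution.Hauser2010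
open Literature.AlgebraicGeometry.Resolution.PointBlowup
open Literature.AlgebraicGeometry.Resolution.WeightedBlowup
open Summit.ResolutionOfSingularities.ResolutionOfSingularities.Theses
open Summit.ResolutionOfSingularities.ResolutionOfSingularities.Theorems.TightDefectClasses
open Summit.ResolutionOfSingularities.ResolutionOfSingularities.Theorems.TightDefectStrongWalks
open Summit.ResolutionOfSingularities.ResolutionOfSingularities.Theorems.ItineraryCutClasses
open Summit.ResolutionOfSingularities.ResolutionOfSingularities.Theorems.ProximityCut
open Summit.ResolutionOfSingularities.ResolutionOfSingularities.Theorems.ExitLaw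
open Summit.ResolutionOfSingularities.ResolutionOfSingularities.Theorems.PlanarCut
open Summit.ResolutionOfSingularities.ResolutionOfSingularities.Theorems.CoefficientCut

namespace Summit.ResolutionOfSingularities.ResolutionOfSingularities.Theorems.GhostDescent

section Planar

variable {K : Type} [Field K] [DecidableEq K]

/-! ## §1 State level: cleaning never touches what the descent uses -/

omit [DecidableEq K] in
/-- A monomial of a CLEANED polynomial is not a `q`-th power. [folklore] -/
theorem not_isPthPowerExponent_of_clean {q : ℕ} {F : MvPolynomial (Fin 3) K} (hclean : deletePthPowers q F = F)
    {d : Fin 3 →₀ ℕ} (hd : coeff d F ≠ 0) : ¬ IsPthPowerExponent q d := by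
  classical
  intro hP
  have h := congrArg (coeff d) hclean
  rw [coeff_deletePthPowers, if_pos hP] at h
  exact hd h.symm

/-- Coefficients of the stepped state at exponents that are not `q`-th powers are those of the point transform
(cleaning only deletes `q`-th powers). [folklore] -/
theorem coeff_step_of_not_isPthPowerExponent (q : ℕ) (j : Fin 3) (b : Fin 3 → K) (s : State (Fin 3) K)
    {d : Fin 3 →₀ ℕ} (hd : ¬ IsPthPowerExponent q d) :
    coeff d (step q j b s).F = coeff d (translate b (chartTransform q j s.F)) := by
  classical
  show coeff d (deletePthPowers q (pointTransform q j b s)) = _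
  rw [coeff_deletePthPowers, if_neg hd]
  rfl

variable {i j k : Fin 3} (hij : i ≠ j) (hjk : j ≠ k) (hik : i ≠ k)
include hij hjk hik

omit [DecidableEq K] in
/-- The chart exponent of a non-`q`-th power (of degree `≥ q`) is not a `q`-th power: an UNTRANSLATED move creates no
`q`-th powers, so cleaning after it deletes nothing that was not already absent. [folklore] -/
theorem isPthPowerExponent_of_chartExponent (q : ℕ) {d : Fin 3 →₀ ℕ} (hq : q ≤ d.degree)
    (h : IsPthPowerExponent q (chartExponent q j d)) : IsPthPowerExponent q d := by
  rw [isPthPowerExponent_iff] at h ⊢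
  have hi := h i
  have hj := h j
  have hk := h k
  rw [chartExponent_i hij] at hi
  rw [chartExponent_k hjk] at hk
  rw [chartExponent_self] at hj
  have h3 := degree_three hij hjk hik d
  have hdeg : q ∣ d.degree := by
    have e : d.degree = (d.degree - q) + q := by omega
    rw [e]
    exact dvd_add hj (dvd_refl q)
  have hsum : q ∣ d i + d j + d k := h3 ▸ hdeg
  have hdj : q ∣ d j := by
    have e : d j = d i + d j + d k - d i - d k := by omega
    rw [e]
    exact Nat.dvd_sub (Nat.dvd_sub hsum hi) hk
  intro l
  rcases fin3_cases ⟨hij, hjk, hik⟩ l with rfl | rfl | rfl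
  · exact hi
  · exact hdj
  · exact hk

omit hik in
/-- An exponent `u_i^l u_j^y u_k^0` with `0 < y < q` is not a `q`-th power. [folklore] -/
theorem not_isPthPowerExponent_exp3 {q l y : ℕ} (hy1 : 1 ≤ y) (hyq : y < q) :
    ¬ IsPthPowerExponent q (exp3 i j k l y 0) := by
  rw [isPthPowerExponent_iff]
  intro h
  have hj := h j
  rw [exp3_j hij hjk] at hj
  have := Nat.le_of_dvd (by omega) hj
  omega

/-- **FORWARD TRANSPORT at an untranslated move, ALL layers of a CLEANED state (PROVED)** — the wall layer `0`
included: the chart exponent of a layer exponent is a layer exponent of the new state. [new] [folklore] -/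
theorem chartExponent_mem_layer_step_of_clean (q : ℕ) (s : State (Fin 3) K) (hF : ∀ d ∈ s.F.support, q ≤ d.degree)
    (hclean : deletePthPowers q s.F = s.F) {a : ℕ} {d : Fin 3 →₀ ℕ} (hd : d ∈ layer k a s.F) :
    chartExponent q j d ∈ layer k a (step q j (0 : Fin 3 → K) s).F := by
  classical
  rw [mem_layer] at hd ⊢
  have hdF : d ∈ s.F.support := MvPolynomial.mem_support_iff.mpr hd.1
  have hnp : ¬ IsPthPowerExponent q (chartExponent q j d) := fun h =>
    not_isPthPowerExponent_of_clean hclean hd.1 (isPthPowerExponent_of_chartExponent hij hjk hik q (hF d hdF) h)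
  refine ⟨?_, by rw [chartExponent_k hjk, hd.2]⟩
  rw [coeff_step_of_not_isPthPowerExponent q j 0 s hnp, translate_zero_eq,
    coeff_chartTransform_chartExponent s.F hF hdF]
  exact hd.1

/-- **THE LOWEST ROW OF THE WALL LAYER `0` AFTER A PLANAR MOVE IS THE ROW POLYNOMIAL (PROVED)** — at every exponent
`u_i^l u_j^{n₀−q}` of that row which is not a `q`-th power (so survives the cleaning). [new] [folklore] -/
theorem coeff_step_row_zero (q : ℕ) (b : Fin 3 → K) (hbj : b j = 0) (hbk : b k = 0) (s : State (Fin 3) K)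
    (hF : ∀ d ∈ s.F.support, q ≤ d.degree) {n₀ : ℕ} (hn₀ : q ≤ n₀) {l : ℕ}
    (hnp : ¬ IsPthPowerExponent q (exp3 i j k l (n₀ - q) 0)) :
    coeff (exp3 i j k l (n₀ - q) 0) (step q j b s).F = (rowPoly i j k 0 n₀ (b i) s.F).coeff l := by
  classical
  rw [coeff_step_of_not_isPthPowerExponent q j b s hnp,
    coeff_pointTransform_planar hij hjk hik q b hbj hbk s.F hF, coeff_rowPoly,
    exp3_i hij hik, exp3_j hij hjk, exp3_k hjk hik]
  unfold layer
  rw [Finset.filter_filter]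
  refine Finset.sum_congr ?_ fun d _ => rfl
  refine Finset.filter_congr fun d hd => ?_
  have := degree_three hij hjk hik d
  constructor
  · rintro ⟨h1, h2⟩
    exact ⟨h1, by omega⟩
  · rintro ⟨h1, h2⟩
    exact ⟨h1, by omega⟩

end Planar

end Summit.ResolutionOfSingularities.ResolutionOfSingularities.Theorems.GhostDescent
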